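import Summits.Ventures.YMGap.RobustBall.StringTensionExplicitW
import Summits.Ventures.YMGap.RobustBall.AxialTowerStringTension
import HarnessLib

/-!
# Robust ball (Y2), area-law side — explicit tier-2 floors through the AFFINE-VERTEX weighted door, and the explicit floor of a
NAMED INFINITE-RANGE member family (the axial tower)

HONEST FRAMING: venture file of the cell `pub-ymgap` (QuantumFields programme), track ROBUST-BALL, seat rb-p2 (g4).  Vertex twin of
`StringTensionExplicitW`: ds-4's affine-vertex weighted slab door (`slabCovarianceW_vertex_of_oneLinkKRModulus`, constants `(8N, τ)` under
`rhoFR N (e^{τ} c_W) ε₀ ε₁ < 1`) run through the full-rate criterion gives the torus bound `N(32N³)^T e^{−(τ/mv)R'T}` on the tier-2 ball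
`ClusterDomain κ ε₀ ε₁ ∩ IsSlabLocal mv` for every `0 ≤ τ ≤ κ/n`, hence `HasAreaLawWith μ χ_N (32N³) (τ/mv)` and `σ ≥ τ/mv` (whenever `σ` exists)
for every infinite-volume limit state of every eventually-member family.  CELL: the `SU(2)`, `d = 4` AXIAL-TOWER family at `β_W = 1/3`
(`towerWitness 4 (L+1) 2 τ (1/2)`, every plaquette coupled to ALL its axial translates with coefficients `τ/2^{s+1}`, `|τ| ≤ 1/6000`; INFINITE
RANGE, in no tier-1 ball — ds-4's `AxialTowerWitness` / `AxialTowerStringTension`): every limit state has `HasAreaLawWith μ χ₂ 256 (log(6/5)/6)` and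
string tension `σ ≥ log(6/5)/6 ≥ 0.0303` whenever it exists (ds-4's landed statement: `∃ C, c > 0`).  LATTICE, strong coupling; the rate is a
door artefact; existence of `σ` is not claimed for this non-Wilson family; nothing continuum / spectral / Clay.

References: H. Föllmer, LNM 1362 (1988) Ch. I Cor. (2.14); Cao–Nissim–Sheffield arXiv:2509.04688v2 Thm 2.3; E. Seiler, LNP 159 (1982) §2.
-/

noncomputable section

open MeasureTheory Filter Topology
open Literature.Probability.LatticeModels (Site)
open Literature.MathematicalPhysics.QuantumLattice
open Literature.MathematicalPhysics.QuantumFieldTheory hiding ZdEdge Site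
open Literature.MathematicalPhysics.QuantumFieldTheory.Balaban1983to89.StrongCouplingDobrushinWindow (OneLinkKRModulus)

namespace Summit.Ventures.YMGap.RobustBall

namespace StringTensionExplicitW

open StringTensionExplicit

variable {n N : ℕ}

/-- **EXPLICIT-RATE AREA LAW ON THE TIER-2 BALL, AFFINE-VERTEX WEIGHTED DOOR** (tree coupling `β`): `N ≥ 2`, one-link modulus on the slab
ball `R ≥ 2n|β/N|`, `κ ≥ 0`, `0 ≤ τ`, `τ n ≤ κ`, `0 ≤ ε₁`, `mv ≥ 1`, and `rhoFR N (e^{τ}·2n|β/N|K) ε₀ ε₁ < 1`.  Then for every torus `L`,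
every `W ∈ ClusterDomain κ ε₀ ε₁` with `IsSlabLocal mv W` and every loop with `2R', 2T ≤ L`:
`|⟨W_{R'×T}⟩_{μ_{β,W,L}}| ≤ N · (32N³)^T · e^{−(τ/mv) R' T}`. [cite: Follmer1988, Ch. I Corollary (2.14)] -/
theorem abs_expectation_wilsonLoop_le_onBallW_vertex (hN : 2 ≤ N) (β : ℝ) {R K : ℝ} (hK : 0 ≤ K)
    (hmod : OneLinkKRModulus N R K) (hR : |β / N| * (2 * (n : ℝ)) ≤ R) {κ τ ε₀ ε₁ : ℝ} (hκ : 0 ≤ κ) (hτ : 0 ≤ τ)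
    (hτκ : τ * n ≤ κ) (h₁ : 0 ≤ ε₁) {mv : ℕ} (hmv : 1 ≤ mv)
    (hρ : rhoFR N (Real.exp τ * (2 * (n : ℝ) * |β / N| * K)) ε₀ ε₁ < 1)
    (L : ℕ) [NeZero L] (W : Perturbation (n + 1) L N) (hWball : W ∈ ClusterDomain κ ε₀ ε₁) (hWloc : IsSlabLocal mv W)
    (x : Literature.MathematicalPhysics.QuantumFieldTheory.Site (n + 1) L) {i j : Fin (n + 1)} (hij : i ≠ j) {R' T : ℕ}
    (hRL : 2 * R' ≤ L) (hTL : 2 * T ≤ L) :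
    |W.expectation (fundamentalRep (Fin N)) β (wilsonLoop (fundamentalRep (Fin N)) x i j R' T)| ≤
      N * (32 * (N : ℝ) ^ 3) ^ T * Real.exp (-(τ / mv) * ((R' : ℝ) * T)) := by
  have hNr : (N : ℝ) ≠ 0 := by exact_mod_cast (show N ≠ 0 by omega)
  have hN1 : (1 : ℝ) ≤ N := by exact_mod_cast (show 1 ≤ N by omega)
  have hβ : (N : ℝ) * (β / N) = β := by field_simp
  have hC₁ : (0 : ℝ) ≤ 8 * N := by positivity
  have h := abs_expectation_wilsonLoop_le_full_rate (n := n) (L := L) hN (β / N) W hmv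
    (fun v => hasVerticalRange_total_of_isSlabLocal hWloc v)
    (fun v t U => total_slabRotate_centre_of_isSlabLocal (by omega) hWloc v t U) hC₁ hτ
    (fun v t rest x' y' i' j' k' l' φ ψ hφ hψ =>
      slabCovarianceW_vertex_of_oneLinkKRModulus (n := n) (by omega) (β / N) hK hmod hR hκ hτ hτκ h₁ mv hρ L W hWball hWloc
        v t rest x' y' i' j' k' l' φ ψ hφ hψ) x hij hRL hTL
  rw [hβ] at h
  have hmax : max (4 * (8 * (N : ℝ))) 1 = 32 * N := by rw [max_eq_left (by nlinarith)]; ring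
  have hpow : (N : ℝ) ^ 2 * (32 * N) = 32 * (N : ℝ) ^ 3 := by ring
  rw [hmax, hpow] at h
  exact h

/-- **EXPLICIT AREA LAW AND STRING-TENSION FLOOR OF EVERY LIMIT STATE ON THE TIER-2 BALL, VERTEX DOOR** (dimension `n + 1 ≥ 2`): every
infinite-volume limit state `μ` of every family eventually in `ClusterDomain κ ε₀ ε₁ ∩ IsSlabLocal mv` satisfies
`HasAreaLawWith μ χ_N (32N³) (τ/mv)` and has string tension `σ ≥ τ/mv` whenever it exists. [folklore] -/
theorem stringTension_ge_onBallW_vertex (hN : 2 ≤ N) (hn : 1 ≤ n) (β : ℝ) {R K : ℝ} (hK : 0 ≤ K)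
    (hmod : OneLinkKRModulus N R K) (hR : |β / N| * (2 * (n : ℝ)) ≤ R) {κ τ ε₀ ε₁ : ℝ} (hκ : 0 ≤ κ) (hτ : 0 ≤ τ)
    (hτκ : τ * n ≤ κ) (h₁ : 0 ≤ ε₁) {mv : ℕ} (hmv : 1 ≤ mv)
    (hρ : rhoFR N (Real.exp τ * (2 * (n : ℝ) * |β / N| * K)) ε₀ ε₁ < 1)
    (𝓦 : PerturbationFamily (n + 1) N) (h𝓦 : ∀ᶠ L : ℕ in atTop, 𝓦 L ∈ ClusterDomain κ ε₀ ε₁ ∧ IsSlabLocal mv (𝓦 L))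
    {μ : Measure (LGConfig (n + 1) (SUN N))} (hμ : μ ∈ perturbedLimitPoints β 𝓦) :
    haveI : NeZero (n + 1) := ⟨by omega⟩
    HasAreaLawWith μ (fun g => normalisedCharacter N (fundamentalRep (Fin N) g)) (32 * (N : ℝ) ^ 3) (τ / mv) ∧
      ∀ σ : ℝ, HasStringTension μ (fun g => normalisedCharacter N (fundamentalRep (Fin N) g)) σ → τ / mv ≤ σ := by
  haveI : NeZero (n + 1) := ⟨by omega⟩
  have hN1 : (1 : ℝ) ≤ N := by exact_mod_cast (show 1 ≤ N by omega)
  have hND : (N : ℝ) ≤ 32 * (N : ℝ) ^ 3 := by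
    have h3 : (N : ℝ) ≤ (N : ℝ) ^ 3 := le_self_pow₀ hN1 (by norm_num)
    nlinarith
  have h01 : (0 : Fin (n + 1)) ≠ 1 := fin_zero_ne_one_of_two_le (by omega)
  have hA : HasAreaLawWith μ (fun g => normalisedCharacter N (fundamentalRep (Fin N) g)) (32 * (N : ℝ) ^ 3) (τ / mv) := by
    refine hasAreaLawWith_of_torusBound (β := β) (fun L => {W | W ∈ ClusterDomain κ ε₀ ε₁ ∧ IsSlabLocal mv W})
      (fun L W hW R' T hR' _ hRL hTL => ?_) 𝓦 h𝓦 hμ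
    have h := abs_expectation_wilsonLoop_le_onBallW_vertex (n := n) hN β hK hmod hR hκ hτ hτκ h₁ hmv hρ (L + 1) W hW.1 hW.2
      (0 : Literature.MathematicalPhysics.QuantumFieldTheory.Site (n + 1) (L + 1)) h01 hRL hTL
    exact le_pow_perimeter_of_le hN1 hND (Real.exp_pos _).le hR' h
  exact ⟨hA, fun σ hσ => hA.le_of_hasStringTension hσ⟩

/-- **SU(2), d = 4 tier-2 VERTEX string-tension floor, schematic** (`K = 1` on radius `≤ 1`, `τ = κ/3`): under
`rhoFR 2 (e^{κ/3}·3β_W/2) ε₀ ε₁ < 1`, every infinite-volume limit state of every family eventually in `ClusterDomain κ ε₀ ε₁ ∩ IsSlabLocal mv`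
(tree coupling `β_W/2`) has `HasAreaLawWith μ χ₂ 256 (κ/(3 mv))` and string tension `σ ≥ κ/(3 mv)` whenever it exists. [folklore] -/
theorem su2_stringTension_ge_onBallW_vertex_of_row {βW κ ε₀ ε₁ : ℝ} (hβ : 0 ≤ βW) (hβ1 : 3 * βW / 2 ≤ 1) (hκ : 0 < κ)
    (h₁ : 0 ≤ ε₁) {mv : ℕ} (hmv : 1 ≤ mv) (hρ : rhoFR 2 (Real.exp (κ / 3) * (3 * βW / 2)) ε₀ ε₁ < 1)
    (𝓦 : PerturbationFamily 4 2) (h𝓦 : ∀ᶠ L : ℕ in atTop, 𝓦 L ∈ ClusterDomain κ ε₀ ε₁ ∧ IsSlabLocal mv (𝓦 L))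
    {μ : Measure (LGConfig 4 (SUN 2))} (hμ : μ ∈ perturbedLimitPoints (βW / 2) 𝓦) :
    HasAreaLawWith μ (fun g => normalisedCharacter 2 (fundamentalRep (Fin 2) g)) 256 (κ / (3 * mv)) ∧
      ∀ σ : ℝ, HasStringTension μ (fun g => normalisedCharacter 2 (fundamentalRep (Fin 2) g)) σ → κ / (3 * mv) ≤ σ := by
  have hmod := SlabAreaLawDimensions.su2_oneLinkKRModulus_of_le_one (R := 3 * βW / 2) hβ1
  have habs : |βW / 2 / ((2 : ℕ) : ℝ)| = βW / 4 := by
    rw [abs_of_nonneg (by positivity)]; push_cast; ring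
  have hτ : 0 ≤ κ / 3 := by positivity
  have hτκ : κ / 3 * ((3 : ℕ) : ℝ) ≤ κ := by push_cast; linarith
  have hρ' : rhoFR 2 (Real.exp (κ / 3) * (2 * ((3 : ℕ) : ℝ) * |βW / 2 / ((2 : ℕ) : ℝ)| * 1)) ε₀ ε₁ < 1 := by
    have e : Real.exp (κ / 3) * (2 * ((3 : ℕ) : ℝ) * |βW / 2 / ((2 : ℕ) : ℝ)| * 1) = Real.exp (κ / 3) * (3 * βW / 2) := by
      rw [habs]; push_cast; ring
    rw [e]; exact hρ
  have h := stringTension_ge_onBallW_vertex (n := 3) (N := 2) le_rfl (by norm_num) (βW / 2) zero_le_one hmod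
    (by rw [habs]; push_cast; linarith) hκ.le hτ hτκ h₁ hmv hρ' 𝓦 h𝓦 hμ
  have e1 : (32 : ℝ) * ((2 : ℕ) : ℝ) ^ 3 = 256 := by norm_num
  have e2 : κ / 3 / ((mv : ℕ) : ℝ) = κ / (3 * mv) := by rw [div_div]
  rw [e1, e2] at h
  exact h

/-! ### The axial tower: an infinite-range member family with an explicit floor -/

/-- ★ **EXPLICIT STRING-TENSION FLOOR FOR AN INFINITE-RANGE MEMBER FAMILY: the SU(2), d = 4 AXIAL TOWER at `β_W = 1/3`.**  For every
`|τ| ≤ 1/6000` and every infinite-volume limit state `μ` of the family `L ↦ towerWitness 4 (L+1) 2 τ (1/2)` (every plaquette coupled to ALL its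
axial translates, coefficients `τ/2^{s+1}`; in no tier-1 ball) at tree coupling `1/6`: `HasAreaLawWith μ χ₂ 256 (log(6/5)/6)` and
`σ ≥ log(6/5)/6` (`≥ 0.0303`) whenever the string tension exists (ds-4's vertex row `(1/3; log 6/5; 7/25, 7/50)`, window `mv = 2`).  Limit states
exist (`su2_towerWitness_limitPoints_nonempty`). [folklore] -/
theorem su2_towerWitness_stringTension_explicit {τ : ℝ} (hτ : |τ| ≤ 1 / 6000) {μ : Measure (LGConfig 4 (SUN 2))}
    (hμ : μ ∈ perturbedLimitPoints (1 / 6) (fun L => towerWitness 4 (L + 1) 2 τ (1 / 2))) :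
    HasAreaLawWith μ (fun g => normalisedCharacter 2 (fundamentalRep (Fin 2) g)) 256 (Real.log (6 / 5) / 6) ∧
      ∀ σ : ℝ, HasStringTension μ (fun g => normalisedCharacter 2 (fundamentalRep (Fin 2) g)) σ → Real.log (6 / 5) / 6 ≤ σ := by
  have hmem : ∀ᶠ L : ℕ in atTop, (fun L => towerWitness 4 (L + 1) 2 τ (1 / 2)) L ∈ ClusterDomain (Real.log (6 / 5)) (7 / 25) (7 / 50) ∧
      IsSlabLocal 2 ((fun L => towerWitness 4 (L + 1) 2 τ (1 / 2)) L) :=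
    Eventually.of_forall fun L => ⟨su2_towerWitness_mem_clusterDomain hτ, isSlabLocal_towerWitness 2 τ (1 / 2)⟩
  have hρ : rhoFR 2 (Real.exp (Real.log (6 / 5) / 3) * (3 * (1 / 3) / 2)) (7 / 25) (7 / 50) < 1 :=
    rhoFR_two_lt_one_of_bounds (by norm_num) (by norm_num) exp_log_six_fifths_div_three_le
      (exp_le_taylor4 (x := 7 / 25) (by norm_num) (by norm_num)) sqrt_two_le (by norm_num) (by norm_num)
  have h6 : (1 / 6 : ℝ) = 1 / 3 / 2 := by norm_num
  rw [h6] at hμ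
  have h := su2_stringTension_ge_onBallW_vertex_of_row (βW := 1 / 3) (by norm_num) (by norm_num) (Real.log_pos (by norm_num))
    (by norm_num) (mv := 2) (by norm_num) hρ _ hmem hμ
  have e : Real.log (6 / 5) / (3 * ((2 : ℕ) : ℝ)) = Real.log (6 / 5) / 6 := by norm_num
  rw [e] at h
  exact h

end StringTensionExplicitW

end Summit.Ventures.YMGap.RobustBall
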